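import Summits.Ventures.CertifiedManyBodySolver.Theorems.CovHg1201M19SlantParts
import Summits.Ventures.CertifiedManyBodySolver.Downfold.BoxesHg1201EKinematicCoverTp2
import Summits.Ventures.CertifiedManyBodySolver.Downfold.BoxesHg1201ESlantCut2Slots
import HarnessLib

/-!
# Theorems/CovHg1201M19Slant2Parts.lean — route «CovHg1201M19» (Hg-1201 M19 @0): under the captain's FALLBACK RUNG («TP-KINCUT-2», `t′ = −213/400`) the certificate part of BOTH
# cruxes is the FALLBACK TRIANGLE `{σ ∈ [−27/50, −213/400], n ∈ [43/50, 22/25], n ≥ 43/50 + (8/3)(σ + 27/50)}` — `3/4` of today's triangle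

Supports stmt-Ventures-27756 «PatchBottomM19» (and stmt-Ventures-27755 «PatchLeftEdgeM19»). INSURANCE geometry (captain hubbard-cov-hg1201-plan-1 RULING hubbard-obs STATUS l.2966).
Ingredients: this seat's `covHg1201M19_Patch…M19_of_triangle` (`Theorems/CovHg1201M19SlantParts.lean`, p634127), hubbard-cov-hg1201-box-2 g1's inner-slot-2 word
`hg1201M19_innerSlot2_orbitMean_ge_negBar` (`Downfold/BoxesHg1201EKinematicCoverTp2.lean`: slots `σ ∈ [−213/400, −13/25]` state-free at every `n ≤ 22/25`, M19 bar′) and this seat's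
words under the steeper SLANT-2 chord (`Downfold/BoxesHg1201ESlantCut2Slots.lean`, `∀ b` side condition).
* `covHg1201M19_PatchBottomM19_of_fallbackTriangle2` / `covHg1201M19_PatchLeftEdgeM19_of_fallbackTriangle2`: (item restricted to the FALLBACK TRIANGLE) → item; both at once.
HONEST FRAMING: set algebra + one-body kinematics + the torus-limit variational inequality; zero solve, no claim node, no definition; CONDITIONAL on the fallback triangle; certified
stiffness-scale CEILINGS on a downfolded screening-grade box = CONTROL / CALIBRATION + labelled heuristic (xx1); a ceiling never speaks to the presence of superconductivity; not a
`T_c`, phase or pressure sentence; NO item, stub or rung leaf is closed by this file; no summit statement is proved. Seat hubbard-cov-hg1201-unc-2 g3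
(`prover-hubbard-cov-hg1201-unc-2-g2-0`), cell `pub/hubbard-downfold`.
-/

noncomputable section

namespace Summit.Ventures.CertifiedManyBodySolver.Theorems

open Set Filter Topology
open Summit.Ventures.CertifiedManyBodySolver.Theses.CovHg1201M19
open Summit.Ventures.CertifiedManyBodySolver.Observables
open Summit.Ventures.CertifiedManyBodySolver.Downfold
open Summit.Ventures.CertifiedManyBodySolver
open Literature.MathematicalPhysics.QuantumLattice Literature.MathematicalPhysics.QuantumLattice.ThermodynamicLimit
open Literature.Probability.LatticeModels
open Matrix HubbardWave0
open scoped BigOperators ComplexOrder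

/-- **«PatchBottomM19» (stmt-Ventures-27756) from its FALLBACK TRIANGLE**: the item restricted to `σ ∈ [−27/50, −213/400]`, `n ≥ 43/50 + (8/3)(σ + 27/50)` (sources `s ∈ [−27/50, σ]`,
`n ∈ [43/50, 22/25]`, `U = 7/2`) implies the item — today's triangle (p634127), box-2's inner-slot-2 word for `σ ≥ −213/400` and the trapezoid under the SLANT-2 chord are
state-free. CONDITIONAL on the fallback triangle.
[cite: ScalapinoWhiteZhang1993, §II] [cite: LiebLoss1993, §8, Theorem 8.2] -/
theorem covHg1201M19_PatchBottomM19_of_fallbackTriangle2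
    (h : ∀ n ∈ Set.Icc (43 / 50 : ℝ) (22 / 25), ∀ σ ∈ Set.Icc (-27 / 50 : ℝ) (-213 / 400), 43 / 50 + 8 / 3 * (σ + 27 / 50) ≤ n →
      ∀ s ∈ Set.Icc (-27 / 50 : ℝ) σ,
      ∀ (ω : InfVolFermionState 2) (Ls : ℕ → ℕ) (ψ : ∀ L, Fock (Orb (FermionTorus 2 L))),
      Tendsto Ls atTop atTop →
      (∀ j, IsGroundStateInSector (hubbardTorusTT' (Ls j) 1 s (7 / 2)) (rectN n (Ls j)) 0 (ψ (Ls j))) →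
      (∀ j, star (ψ (Ls j)) ⬝ᵥ ψ (Ls j) = 1) → ω.IsTorusLimitOf ψ Ls →
      -(5084577 / 10000000 : ℝ) ≤ ((Finset.univ : Finset (DihedralGroup 4)).card : ℝ)⁻¹ * ∑ g ∈ (Finset.univ : Finset (DihedralGroup 4)),
        (ω.expect (d4ShiftSet g 0 (Literature.Probability.LatticeModels.box 2 7))
          (fermionEmbed (PolySite.d4Emb g 0 (Literature.Probability.LatticeModels.box 2 7)) (-oddMomentObsTT σ (7 / 2) 0))).re) :
    PatchBottomM19 := by
  refine covHg1201M19_PatchBottomM19_of_triangle (fun n hn σ hσ _ s hs ω Ls ψ hLs hψ h1 hω => ?_)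
  rcases le_or_gt σ (-213 / 400) with hσ2 | hσ2
  · rcases le_or_gt n (43 / 50 + 8 / 3 * (σ + 27 / 50)) with hle | hgt
    · exact hg1201M19_patchBottomM19_slant2Slots_kinematic n hn σ ⟨hσ.1, hσ2⟩ hle s hs ω Ls ψ hLs hψ h1 hω
    · exact h n hn σ ⟨hσ.1, hσ2⟩ hgt.le s hs ω Ls ψ hLs hψ h1 hω
  · exact hg1201M19_innerSlot2_orbitMean_ge_negBar σ (7 / 2) s (7 / 2) ⟨hσ2.le, by linarith [hσ.2]⟩ (by linarith [hn.1]) hn.2 ω Ls ψ hLs hψ h1 hω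

/-- **«PatchLeftEdgeM19» (stmt-Ventures-27755) from its FALLBACK TRIANGLE**: the item restricted to `σ ∈ [−27/50, −213/400]`, `n ≥ 43/50 + (8/3)(σ + 27/50)` (states at `(−27/50, U′, n)`,
`U′ ∈ [7/2, 44/5]`, `n ∈ [43/50, 22/25]`) implies the item. CONDITIONAL on the fallback triangle. [cite: ScalapinoWhiteZhang1993, §II] [cite: LiebLoss1993, §8, Theorem 8.2] -/
theorem covHg1201M19_PatchLeftEdgeM19_of_fallbackTriangle2
    (h : ∀ n ∈ Set.Icc (43 / 50 : ℝ) (22 / 25), ∀ σ ∈ Set.Icc (-27 / 50 : ℝ) (-213 / 400), 43 / 50 + 8 / 3 * (σ + 27 / 50) ≤ n →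
      ∀ U' ∈ Set.Icc (7 / 2 : ℝ) (44 / 5),
      ∀ (ω : InfVolFermionState 2) (Ls : ℕ → ℕ) (ψ : ∀ L, Fock (Orb (FermionTorus 2 L))),
      Tendsto Ls atTop atTop →
      (∀ j, IsGroundStateInSector (hubbardTorusTT' (Ls j) 1 (-27 / 50) U') (rectN n (Ls j)) 0 (ψ (Ls j))) →
      (∀ j, star (ψ (Ls j)) ⬝ᵥ ψ (Ls j) = 1) → ω.IsTorusLimitOf ψ Ls →
      -(5084577 / 10000000 : ℝ) ≤ ((Finset.univ : Finset (DihedralGroup 4)).card : ℝ)⁻¹ * ∑ g ∈ (Finset.univ : Finset (DihedralGroup 4)),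
        (ω.expect (d4ShiftSet g 0 (Literature.Probability.LatticeModels.box 2 7))
          (fermionEmbed (PolySite.d4Emb g 0 (Literature.Probability.LatticeModels.box 2 7)) (-oddMomentObsTT σ U' 0))).re) :
    PatchLeftEdgeM19 := by
  refine covHg1201M19_PatchLeftEdgeM19_of_triangle (fun n hn σ hσ _ U' hU' ω Ls ψ hLs hψ h1 hω => ?_)
  rcases le_or_gt σ (-213 / 400) with hσ2 | hσ2
  · rcases le_or_gt n (43 / 50 + 8 / 3 * (σ + 27 / 50)) with hle | hgt
    · exact hg1201M19_patchLeftEdgeM19_slant2Slots_kinematic n hn σ ⟨hσ.1, hσ2⟩ hle U' hU' ω Ls ψ hLs hψ h1 hω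
    · exact h n hn σ ⟨hσ.1, hσ2⟩ hgt.le U' hU' ω Ls ψ hLs hψ h1 hω
  · exact hg1201M19_innerSlot2_orbitMean_ge_negBar σ U' (-27 / 50) U' ⟨hσ2.le, by linarith [hσ.2]⟩ (by linarith [hn.1]) hn.2 ω Ls ψ hLs hψ h1 hω

/-- **Both cruxes of «CovHg1201M19» from their FALLBACK TRIANGLES at once** (`3/352` of the M19 face each). [cite: ScalapinoWhiteZhang1993, §II] -/
theorem covHg1201M19_cruxes_of_fallbackTriangles2
    (hB : ∀ n ∈ Set.Icc (43 / 50 : ℝ) (22 / 25), ∀ σ ∈ Set.Icc (-27 / 50 : ℝ) (-213 / 400), 43 / 50 + 8 / 3 * (σ + 27 / 50) ≤ n →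
      ∀ s ∈ Set.Icc (-27 / 50 : ℝ) σ,
      ∀ (ω : InfVolFermionState 2) (Ls : ℕ → ℕ) (ψ : ∀ L, Fock (Orb (FermionTorus 2 L))),
      Tendsto Ls atTop atTop →
      (∀ j, IsGroundStateInSector (hubbardTorusTT' (Ls j) 1 s (7 / 2)) (rectN n (Ls j)) 0 (ψ (Ls j))) →
      (∀ j, star (ψ (Ls j)) ⬝ᵥ ψ (Ls j) = 1) → ω.IsTorusLimitOf ψ Ls →
      -(5084577 / 10000000 : ℝ) ≤ ((Finset.univ : Finset (DihedralGroup 4)).card : ℝ)⁻¹ * ∑ g ∈ (Finset.univ : Finset (DihedralGroup 4)),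
        (ω.expect (d4ShiftSet g 0 (Literature.Probability.LatticeModels.box 2 7))
          (fermionEmbed (PolySite.d4Emb g 0 (Literature.Probability.LatticeModels.box 2 7)) (-oddMomentObsTT σ (7 / 2) 0))).re)
    (hL : ∀ n ∈ Set.Icc (43 / 50 : ℝ) (22 / 25), ∀ σ ∈ Set.Icc (-27 / 50 : ℝ) (-213 / 400), 43 / 50 + 8 / 3 * (σ + 27 / 50) ≤ n →
      ∀ U' ∈ Set.Icc (7 / 2 : ℝ) (44 / 5),
      ∀ (ω : InfVolFermionState 2) (Ls : ℕ → ℕ) (ψ : ∀ L, Fock (Orb (FermionTorus 2 L))),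
      Tendsto Ls atTop atTop →
      (∀ j, IsGroundStateInSector (hubbardTorusTT' (Ls j) 1 (-27 / 50) U') (rectN n (Ls j)) 0 (ψ (Ls j))) →
      (∀ j, star (ψ (Ls j)) ⬝ᵥ ψ (Ls j) = 1) → ω.IsTorusLimitOf ψ Ls →
      -(5084577 / 10000000 : ℝ) ≤ ((Finset.univ : Finset (DihedralGroup 4)).card : ℝ)⁻¹ * ∑ g ∈ (Finset.univ : Finset (DihedralGroup 4)),
        (ω.expect (d4ShiftSet g 0 (Literature.Probability.LatticeModels.box 2 7))
          (fermionEmbed (PolySite.d4Emb g 0 (Literature.Probability.LatticeModels.box 2 7)) (-oddMomentObsTT σ U' 0))).re) :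
    PatchBottomM19 ∧ PatchLeftEdgeM19 :=
  ⟨covHg1201M19_PatchBottomM19_of_fallbackTriangle2 hB, covHg1201M19_PatchLeftEdgeM19_of_fallbackTriangle2 hL⟩

end Summit.Ventures.CertifiedManyBodySolver.Theorems

end
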